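import Mathlib
import Summits.Ventures.HodgeRepro.Tier4.Target
import Summits.Ventures.HodgeRepro.Tier4.Line3.Defs
import Summits.Ventures.HodgeRepro.Tier4.Line3.LocaliserS
import Summits.Ventures.HodgeRepro.Tier4.Line3.Majorant
import Summits.Ventures.HodgeRepro.Tier4.Line3.OffMainOrbit
import Summits.Ventures.HodgeRepro.Tier4.Line3.SylvesterTransfer
import Summits.Ventures.HodgeRepro.Tier4.Line3.DefiniteBound
import Summits.Ventures.HodgeRepro.Tier4.Line3.ClassBoundLemmas
import Summits.Ventures.HodgeRepro.Tier4.Line3.ClassBoundGauss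
import Summits.Ventures.HodgeRepro.Tier4.Line3.InvariantMajorantDef

/-!
# Tier4/Line3/InvariantClassBound — THE CLASS BOUND WITH A `Γ`-INVARIANT MAJORANT (rung (I3) of S12951)

Blind re-derivation cell `pub-hodge-repro`, Tier 4 «PROVE THE STEP» (README §9–§10), LINE L3, seat t4-L2-p3 (gen 2,
on L3.5 `term_dominated`); support module for the residual `OffMainMass` of L3.5 through the invariant-majorant route.

`ClassBound.summand_bound_off_main` majorises every off-main summand of the depth-`N` localiser by
`B · majorantAt · C₁ e^{−κ q^{N/d}}`, with the NON-invariant majorant `majorantAt` (ball coordinates at `τ₀`).  This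
module proves the same decay with the `Γ`-INVARIANT majorant `invMajorant` of `InvariantMajorantDef`, under ONE
displayed hypothesis on the localiser, `GrowthInv` — the growth clause of `LocS` evaluated at every `Γ`-translate of
the slots (S12951 (3), S12979):

  `‖coefQ (loc N) (rep w)‖ ≤ B q₂^N · quadMaj e c₀ (rep w) g · ∏_k gaussDefAt c₀ (rep w k)`  for every `g ∈ Γ⁴`,

i.e. the polynomial factor and a definite Gaussian at the translated slots `g_k x_k`, times a definite Gaussian at the
quadruple itself.  For the genuine data the coefficient function is bounded by the CONTENT of each slot (a
`Γ`-invariant, `ThetaData.invΓ`) times the definite-place Gaussian of `H_σ` (invariant under all of `U(H)(E′)`); the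
clause follows by splitting that Gaussian into two halves, one moved to `g_k x_k` (invariance), each dominated by a
Euclidean Gaussian `gaussDefAt` (definiteness of `H_σ`).  `q₂^N` is the geometric room a depth-`N` Hecke combination
costs.  With it:

  `‖summand (loc N) w z‖ ≤ B q₂^N · invMajorant D e c₀ w z · C₁ e^{−κ q^{N/d}}`  (off-main `w`, `z ∈ 𝔹`)

(`summand_bound_off_main_inv`): the Gram deviation of a support tuple is large at some embedding `σ`
(`OffMainOrbit.exists_gram_dev_size`, as in `ClassBound`); if `σ` is definite the Gaussian `∏_k gaussDefAt c₀ (rep w k)`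
at the quadruple pays (`DefiniteBound`), if `σ ∈ {τ₀, τ̄₀}` a QUARTER of the kernel's Gaussian pays
(`rung_hform_le_maj` — the other quarter is kept in `kerMaj`); the bound holds for every `g`, hence for the infimum
`gammaInf`.  No printed input enters.  Nothing here asserts anything about the truth of (P); HC_CM is NOT proved by
anyone in this repository.
-/

set_option autoImplicit false

noncomputable section

namespace Summit.Ventures.HodgeRepro.Tier4.Line3

open Summit.Ventures.HodgeRepro.Tier4
open Matrix NumberField
open scoped ComplexConjugate

namespace T4Data

variable (X : T4Data)

/-- **THE `Γ`-INVARIANT GROWTH CLAUSE** of a localiser (S12951 (3)): the coefficient is bounded by the slot majorant at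
EVERY `Γ`-translate of the slots, times the definite Gaussian of the quadruple, with geometric growth `q₂^N` in the
depth. -/
def GrowthInv (D : X.ThetaData) (p : IsDedekindDomain.HeightOneSpectrum (RingOfIntegers X.E))
    (L₀ : Submodule (RingOfIntegers X.E) (Fin 3 → X.E)) (xm : X.Tuple) (ℓ : X.LocS D p L₀ xm) : Prop :=
  ∃ B q₂ e c₀ : ℝ, 0 < c₀ ∧ 0 ≤ q₂ ∧ ∀ (N : ℕ) (w : X.LineTuple) (g : Fin 4 → X.Γ),
    ‖X.coefQ D.cf (ℓ.loc N) (X.rep w)‖ ≤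
      B * q₂ ^ N * X.quadMaj e c₀ (X.rep w) g * ∏ k, X.gaussDefAt c₀ (X.rep w k)

/-- The quarter-Gaussian product with two slots singled out (`prod_exp_half_le` at `m / 2`). -/
theorem prod_exp_quarter_le {m : Fin 4 → ℝ} (hm : ∀ k, 0 ≤ m k) (i j : Fin 4) (R : ℝ)
    (hR : (i ≠ j → R ≤ m i + m j) ∧ (i = j → R ≤ m i)) :
    ∏ k, Real.exp (-(Real.pi / 4) * m k) ≤ Real.exp (-(Real.pi / 4) * R) := by
  have h := prod_exp_half_le (m := fun k => m k / 2) (fun k => by linarith [hm k]) i j (R / 2)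
    ⟨fun hij => by linarith [hR.1 hij], fun hij => by linarith [hR.2 hij]⟩
  have e1 : ∀ k, Real.exp (-(Real.pi / 4) * m k) = Real.exp (-(Real.pi / 2) * (m k / 2)) := fun k => by
    congr 1
    ring
  have e2 : Real.exp (-(Real.pi / 4) * R) = Real.exp (-(Real.pi / 2) * (R / 2)) := by
    congr 1
    ring
  simp only [e1, e2]
  exact h

/-- **THE DECAY FROM ONE LARGE GRAM ENTRY** (quarter-Gaussian version of the decay step of `ClassBound`): if
`R' ≤ ‖σ (gram x i j)‖` at some embedding `σ`, the definite Gaussians of the quadruple times the quarter Gaussians of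
the kernel at `x` are `≤ e^{−κ₀ R'}` for `κ₀ ≤ π/4`, `κ₀ ≤ c₀ / (2K)` (`K` a bound of `Σ ‖σ H‖` over the embeddings). -/
theorem decay_quarter_of_gram_entry {c₀ : ℝ} (hc₀ : 0 < c₀) {K : ℝ}
    (hK_ge : ∀ σ : X.E →+* ℂ, ∑ k, ∑ l, ‖σ (X.H k l)‖ ≤ K) {κ₀ : ℝ} (hκ₀_pos : 0 < κ₀)
    (hκ₀_le1 : κ₀ ≤ Real.pi / 4) (hκ₀_le2 : κ₀ ≤ c₀ / (2 * K)) (x : X.Tuple) {z : Fin 2 → ℂ} (hz : z ∈ ball) (σ : X.E →+* ℂ) (i j : Fin 4)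
    {R' : ℝ} (hgram_ge : R' ≤ ‖σ (X.gram x i j)‖) :
    (∏ k, X.gaussDefAt c₀ (x k)) * (∏ k, Real.exp (-(Real.pi / 4) * maj (X.ballCoord (x k)) z)) ≤
      Real.exp (-(κ₀ * R')) := by
  obtain ⟨G, hG⟩ : ∃ G : ℝ, G = ∏ k, X.gaussDefAt c₀ (x k) := ⟨_, rfl⟩
  obtain ⟨Hf, hHf⟩ : ∃ Hf : ℝ, Hf = ∏ k, Real.exp (-(Real.pi / 4) * maj (X.ballCoord (x k)) z) := ⟨_, rfl⟩
  rw [← hG, ← hHf]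
  have hG0 : 0 ≤ G := by rw [hG]; exact Finset.prod_nonneg fun k _ => X.gaussDefAt_nonneg _ _
  have hG1 : G ≤ 1 := by
    rw [hG]
    exact Finset.prod_le_one (fun k _ => X.gaussDefAt_nonneg _ _) fun k _ => X.gaussDefAt_le_one hc₀.le _
  have hHf0 : 0 ≤ Hf := by rw [hHf]; exact Finset.prod_nonneg fun k _ => (Real.exp_pos _).le
  have hHf1 : Hf ≤ 1 := by
    rw [hHf]
    refine Finset.prod_le_one (fun k _ => (Real.exp_pos _).le) fun k _ => ?_
    rw [Real.exp_le_one_iff]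
    have h := maj_nonneg' (X.ballCoord (x k)) z hz
    have h' : 0 ≤ Real.pi / 4 * maj (X.ballCoord (x k)) z := by positivity
    linarith
  rcases le_or_gt 0 R' with hR'0 | hR'0
  · by_cases hσtau : σ = X.τ₀ ∨ σ = conjEmb X.τ₀
    · -- the `τ₀` case: the kernel's quarter Gaussians
      have hnorm : R' ≤ ‖X.τ₀ (hform X.c X.H (x i) (x j))‖ := by
        rcases hσtau with rfl | rfl
        · exact hgram_ge
        · rw [← X.norm_conjEmb_tau]
          exact hgram_ge
      have hJ : R' ≤ ‖star (X.ballCoord (x i)) ⬝ᵥ (J *ᵥ X.ballCoord (x j))‖ := by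
        rw [X.norm_ballCoord_J]
        exact hnorm
      have hHf' : Hf ≤ Real.exp (-(Real.pi / 4) * R') := by
        rw [hHf]
        refine prod_exp_quarter_le (fun k => maj_nonneg' (X.ballCoord (x k)) z hz) i j R'
          ⟨fun _ => ?_, fun hij => ?_⟩
        · have := rung_hform_le_maj (X.ballCoord (x i)) (X.ballCoord (x j)) z hz
          linarith
        · subst hij
          have h1 := rung_abs_le_maj (X.ballCoord (x i)) z hz
          have hIm : (star (X.ballCoord (x i)) ⬝ᵥ (J *ᵥ X.ballCoord (x i))).im = 0 := by
            simp [dotProduct, J, Matrix.mulVec_diagonal, Fin.sum_univ_three, Complex.mul_im, Complex.conj_re,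
              Complex.conj_im]
            ring
          have hreal := Complex.abs_re_eq_norm.mpr hIm
          rw [← hreal] at hJ
          linarith
      calc G * Hf ≤ 1 * Real.exp (-(Real.pi / 4) * R') := mul_le_mul hG1 hHf' hHf0 zero_le_one
        _ = Real.exp (-(Real.pi / 4) * R') := one_mul _
        _ ≤ Real.exp (-(κ₀ * R')) := by
            apply Real.exp_le_exp.mpr
            have := mul_le_mul_of_nonneg_right hκ₀_le1 hR'0
            linarith
    · -- the definite case: the quadruple's definite Gaussians
      rw [not_or] at hσtau
      have hσc : ∀ t, ‖σ (X.c t)‖ = ‖σ t‖ := fun t => by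
        have h := IsCMField.complexEmbedding_complexConj X.E σ t
        rw [show σ (X.c t) = conj (σ t) from h, Complex.norm_conj]
      obtain ⟨Kσ, hKσ⟩ : ∃ Kσ : ℝ, Kσ = ∑ k, ∑ l, ‖σ (X.H k l)‖ := ⟨_, rfl⟩
      have hKσ_pos : 0 < Kσ := by rw [hKσ]; exact X.sum_norm_emb_H_pos σ
      have hKσ_le : Kσ ≤ K := by rw [hKσ]; exact hK_ge σ
      obtain ⟨Sx, hSx⟩ : ∃ Sx : Fin 4 → ℝ, Sx = fun k => ∑ i, ‖σ (x k i)‖ ^ 2 := ⟨_, rfl⟩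
      have hgS : ∀ k, X.gaussDefAt c₀ (x k) ≤ Real.exp (-(c₀ * Sx k)) := fun k => by
        rw [hSx]
        exact X.gaussDefAt_le_exp hc₀.le (x k) σ hσtau
      have hG' := prod_le_exp_two (g := fun k => X.gaussDefAt c₀ (x k)) (S := Sx) (c := c₀)
        (fun k => X.gaussDefAt_nonneg _ _) (fun k => X.gaussDefAt_le_one hc₀.le _) hgS i j
      rw [← hG] at hG'
      have hsum_ge : R' ≤ Kσ * (Sx i + Sx j) := by
        have hform_le := norm_map_hform_le X.c X.H σ hσc (x i) (x j)
        rw [← hKσ] at hform_le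
        have hSxi : Sx i = ∑ i', ‖σ (x i i')‖ ^ 2 := by rw [hSx]
        have hSxj : Sx j = ∑ l, ‖σ (x j l)‖ ^ 2 := by rw [hSx]
        rw [hSxi, hSxj]
        exact hgram_ge.trans hform_le
      have hGexp : G ≤ Real.exp (-(c₀ / (2 * Kσ) * R')) := by
        refine hG'.trans ?_
        have hc2 : 0 ≤ c₀ / (2 * Kσ) := by positivity
        by_cases hij : i = j
        · subst hij
          simp only [if_true]
          apply Real.exp_le_exp.mpr
          have h2 : R' ≤ (2 * Kσ) * Sx i := by linarith
          have h3 : c₀ / (2 * Kσ) * R' ≤ c₀ * Sx i := by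
            calc c₀ / (2 * Kσ) * R' ≤ c₀ / (2 * Kσ) * ((2 * Kσ) * Sx i) := mul_le_mul_of_nonneg_left h2 hc2
              _ = c₀ * Sx i := by field_simp
          linarith
        · simp only [hij, if_false]
          rw [← Real.exp_add]
          apply Real.exp_le_exp.mpr
          have h3 : c₀ / (2 * Kσ) * R' ≤ c₀ * Sx i + c₀ * Sx j := by
            calc c₀ / (2 * Kσ) * R' ≤ c₀ / (2 * Kσ) * (Kσ * (Sx i + Sx j)) := mul_le_mul_of_nonneg_left hsum_ge hc2
              _ = c₀ * (Sx i + Sx j) / 2 := by field_simp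
              _ ≤ c₀ * Sx i + c₀ * Sx j := by
                  have hSi : 0 ≤ Sx i := by rw [hSx]; exact Finset.sum_nonneg fun _ _ => sq_nonneg _
                  have hSj : 0 ≤ Sx j := by rw [hSx]; exact Finset.sum_nonneg fun _ _ => sq_nonneg _
                  nlinarith
          linarith
      calc G * Hf ≤ Real.exp (-(c₀ / (2 * Kσ) * R')) * 1 := mul_le_mul hGexp hHf1 hHf0 (Real.exp_pos _).le
        _ = Real.exp (-(c₀ / (2 * Kσ) * R')) := mul_one _
        _ ≤ Real.exp (-(κ₀ * R')) := by
            apply Real.exp_le_exp.mpr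
            have h2 : c₀ / (2 * K) ≤ c₀ / (2 * Kσ) :=
              div_le_div_of_nonneg_left hc₀.le (by positivity) (by linarith)
            have := mul_le_mul_of_nonneg_right (hκ₀_le2.trans h2) hR'0
            linarith
  · -- `R' < 0`: the trivial bound `G Hf ≤ 1 ≤ exp (−κ₀ R')`
    calc G * Hf ≤ 1 * 1 := mul_le_mul hG1 hHf1 hHf0 zero_le_one
      _ = 1 := one_mul 1
      _ ≤ Real.exp (-(κ₀ * R')) := by
          rw [Real.one_le_exp_iff]
          nlinarith

/-- **THE CLASS BOUND WITH THE `Γ`-INVARIANT MAJORANT** (rung (I3) of S12951): under the invariant growth clause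
`GrowthInv`, every line tuple OFF the main orbit has its summand bounded, at every depth `N` and every `z ∈ 𝔹`, by
`B q₂^N · invMajorant D e c₁ w z · C₁ e^{−κ (N(𝔭)^N)^{1/d}}`, with `κ > 0`, `c₁ > 0` and `B, q₂, e, C₁` independent of
`N`, `w`, `z`. -/
theorem summand_bound_off_main_inv (D : X.ThetaData) (p : IsDedekindDomain.HeightOneSpectrum (RingOfIntegers X.E))
    (L₀ : Submodule (RingOfIntegers X.E) (Fin 3 → X.E)) (xm : X.Tuple)
    (h02 : xm 2 = xm 0) (h13 : xm 3 = xm 1) (hab : LinearIndependent X.E ![xm 0, xm 1]) (ℓ : X.LocS D p L₀ xm)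
    (hinv : X.GrowthInv D p L₀ xm ℓ) :
    ∃ (B q₂ e κ C₁ c₁ : ℝ), 0 < κ ∧ 0 ≤ B ∧ 0 ≤ q₂ ∧ 0 ≤ C₁ ∧ 0 < c₁ ∧
      ∀ (N : ℕ) (w : X.LineTuple) (z : Fin 2 → ℂ), z ∈ ball →
      X.orbitOf w ≠ X.orbitOf (X.lines xm) →
      ‖X.summand D.Φ D.cf (ℓ.loc N) w z‖ ≤ B * q₂ ^ N * X.invMajorant D e c₁ w z *
        (C₁ * Real.exp (-(κ * (((Ideal.absNorm p.asIdeal : ℝ) ^ N) ^ ((Module.finrank ℚ X.E : ℝ)⁻¹))))) := by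
  classical
  obtain ⟨S, hS, hsupp⟩ := ℓ.supp
  obtain ⟨B, q₂, e, c₀, hc₀, hq₂, hgrowth⟩ := hinv
  have hSfg : ∀ L ∈ S, L.FG := fun L hL => (hS L hL).1.1
  obtain ⟨D₀, hD₀, hdev⟩ := X.exists_gram_dev_size p S hSfg xm h02 h13 hab
  have hdpos : 0 < Module.finrank ℚ X.E := Module.finrank_pos
  -- the constants, kept opaque
  obtain ⟨Dmax, hDmax_pos, hDmax_ge⟩ : ∃ Dmax : ℝ, 0 < Dmax ∧
      ∀ σ : X.E →+* ℂ, ‖σ (algebraMap (RingOfIntegers X.E) X.E D₀)‖ ≤ Dmax := by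
    refine ⟨∑ σ : X.E →+* ℂ, ‖σ (algebraMap (RingOfIntegers X.E) X.E D₀)‖, ?_, fun σ =>
      Finset.single_le_sum (f := fun σ : X.E →+* ℂ => ‖σ (algebraMap (RingOfIntegers X.E) X.E D₀)‖)
        (fun _ _ => norm_nonneg _) (Finset.mem_univ σ)⟩
    obtain ⟨σ₀⟩ : Nonempty (X.E →+* ℂ) := inferInstance
    have hD₀E : algebraMap (RingOfIntegers X.E) X.E D₀ ≠ 0 := by
      intro h
      exact hD₀ ((map_eq_zero_iff _ (RingOfIntegers.coe_injective (K := X.E))).mp h)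
    exact lt_of_lt_of_le (norm_pos_iff.mpr ((map_ne_zero σ₀).mpr hD₀E))
      (Finset.single_le_sum (f := fun σ : X.E →+* ℂ => ‖σ (algebraMap (RingOfIntegers X.E) X.E D₀)‖)
        (fun _ _ => norm_nonneg _) (Finset.mem_univ σ₀))
  obtain ⟨G₀, hG₀_ge⟩ : ∃ G₀ : ℝ, ∀ (σ : X.E →+* ℂ) (i j : Fin 4), ‖σ (X.gram xm i j)‖ ≤ G₀ := by
    refine ⟨∑ σ : X.E →+* ℂ, ∑ i, ∑ j, ‖σ (X.gram xm i j)‖, fun σ i j => ?_⟩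
    calc ‖σ (X.gram xm i j)‖ ≤ ∑ j, ‖σ (X.gram xm i j)‖ :=
          Finset.single_le_sum (f := fun j => ‖σ (X.gram xm i j)‖) (fun _ _ => norm_nonneg _) (Finset.mem_univ j)
      _ ≤ ∑ i, ∑ j, ‖σ (X.gram xm i j)‖ :=
          Finset.single_le_sum (f := fun i => ∑ j, ‖σ (X.gram xm i j)‖)
            (fun _ _ => Finset.sum_nonneg fun _ _ => norm_nonneg _) (Finset.mem_univ i)
      _ ≤ ∑ σ : X.E →+* ℂ, ∑ i, ∑ j, ‖σ (X.gram xm i j)‖ :=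
          Finset.single_le_sum (f := fun σ : X.E →+* ℂ => ∑ i, ∑ j, ‖σ (X.gram xm i j)‖)
            (fun _ _ => Finset.sum_nonneg fun _ _ => Finset.sum_nonneg fun _ _ => norm_nonneg _) (Finset.mem_univ σ)
  obtain ⟨K, hK_pos, hK_ge⟩ : ∃ K : ℝ, 0 < K ∧ ∀ σ : X.E →+* ℂ, ∑ k, ∑ l, ‖σ (X.H k l)‖ ≤ K := by
    refine ⟨∑ σ : X.E →+* ℂ, ∑ k, ∑ l, ‖σ (X.H k l)‖, ?_, fun σ =>
      Finset.single_le_sum (f := fun σ : X.E →+* ℂ => ∑ k, ∑ l, ‖σ (X.H k l)‖)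
        (fun _ _ => Finset.sum_nonneg fun _ _ => Finset.sum_nonneg fun _ _ => norm_nonneg _) (Finset.mem_univ σ)⟩
    obtain ⟨σ₀⟩ : Nonempty (X.E →+* ℂ) := inferInstance
    exact lt_of_lt_of_le (X.sum_norm_emb_H_pos σ₀)
      (Finset.single_le_sum (f := fun σ : X.E →+* ℂ => ∑ k, ∑ l, ‖σ (X.H k l)‖)
        (fun _ _ => Finset.sum_nonneg fun _ _ => Finset.sum_nonneg fun _ _ => norm_nonneg _) (Finset.mem_univ σ₀))
  obtain ⟨κ₀, hκ₀_pos, hκ₀_le1, hκ₀_le2⟩ : ∃ κ₀ : ℝ, 0 < κ₀ ∧ κ₀ ≤ Real.pi / 4 ∧ κ₀ ≤ c₀ / (2 * K) :=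
    ⟨min (Real.pi / 4) (c₀ / (2 * K)), lt_min (by positivity) (by positivity), min_le_left _ _, min_le_right _ _⟩
  refine ⟨max B 0, q₂, e, κ₀ / Dmax, Real.exp (κ₀ * G₀), c₀, by positivity, le_max_right _ _, hq₂,
    (Real.exp_pos _).le, hc₀, ?_⟩
  intro N w z hz hne
  -- the trivial case: zero coefficient
  by_cases hc : X.coefQ D.cf (ℓ.loc N) (X.rep w) = 0
  · unfold summand
    rw [hc, zero_mul, norm_zero]
    exact mul_nonneg (mul_nonneg (mul_nonneg (le_max_right _ _) (pow_nonneg hq₂ _))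
      (X.invMajorant_nonneg _ _ _ _ _)) (mul_nonneg (Real.exp_pos _).le (Real.exp_pos _).le)
  obtain ⟨x, hx, L, hL, hball⟩ := hsupp N w hc
  have hball' : ∀ j, x j - xm j ∈ X.ballIdeal p N • L := by
    intro j
    have := hball j
    rwa [X.conjIdeal_eq_map_cR] at this
  have hne' : X.orbitOf (X.lines x) ≠ X.orbitOf (X.lines xm) := by rwa [hx]
  obtain ⟨i, j, σ, hσ⟩ := hdev N x L hL hball' hne'
  -- the `d`-th root: `RN ≤ ‖σ D₀‖ ‖σ α‖`
  obtain ⟨RN, hRN⟩ : ∃ RN : ℝ, RN = ((Ideal.absNorm p.asIdeal : ℝ) ^ N) ^ ((Module.finrank ℚ X.E : ℝ)⁻¹) := ⟨_, rfl⟩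
  obtain ⟨α, hα⟩ : ∃ α : X.E, α = X.gram x i j - X.gram xm i j := ⟨_, rfl⟩
  have hroot : RN ≤ ‖σ (algebraMap (RingOfIntegers X.E) X.E D₀)‖ * ‖σ α‖ := by
    have h1 : ((Ideal.absNorm p.asIdeal : ℝ) ^ N) ^ ((Module.finrank ℚ X.E : ℝ)⁻¹) ≤
        ((‖σ (algebraMap (RingOfIntegers X.E) X.E D₀)‖ * ‖σ α‖) ^ Module.finrank ℚ X.E) ^
          ((Module.finrank ℚ X.E : ℝ)⁻¹) := by
      apply Real.rpow_le_rpow (by positivity) _ (by positivity)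
      rw [mul_pow, hα]
      exact hσ
    rw [Real.pow_rpow_inv_natCast (by positivity) hdpos.ne'] at h1
    rw [hRN]
    exact h1
  have hα_ge : RN / Dmax ≤ ‖σ α‖ := by
    rw [div_le_iff₀ hDmax_pos]
    calc RN ≤ ‖σ (algebraMap (RingOfIntegers X.E) X.E D₀)‖ * ‖σ α‖ := hroot
      _ ≤ Dmax * ‖σ α‖ := mul_le_mul_of_nonneg_right (hDmax_ge σ) (norm_nonneg _)
      _ = ‖σ α‖ * Dmax := mul_comm _ _
  -- the Gram entry of the ball representative is large at `σ`
  obtain ⟨R', hR'⟩ : ∃ R' : ℝ, R' = RN / Dmax - G₀ := ⟨_, rfl⟩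
  have hgram_ge : R' ≤ ‖σ (X.gram x i j)‖ := by
    have h1 : ‖σ α‖ - ‖σ (X.gram xm i j)‖ ≤ ‖σ (X.gram x i j)‖ := by
      have := norm_sub_le (σ (X.gram x i j)) (σ (X.gram xm i j))
      rw [← map_sub, ← hα] at this
      linarith
    linarith [hG₀_ge σ i j]
  -- the chosen representative is a unit multiple of the ball representative: same Gram sizes
  choose t ht hrep using fun k => X.rep_eq_smul_of_lines_eq hx k
  have hgram_rep : R' ≤ ‖σ (X.gram (X.rep w) i j)‖ := by
    show R' ≤ ‖σ (hform X.c X.H (X.rep w i) (X.rep w j))‖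
    rw [hrep i, hrep j, X.norm_emb_hform_smul_eq σ (ht i) (ht j)]
    exact hgram_ge
  -- the decay
  have hdecay := X.decay_quarter_of_gram_entry hc₀ hK_ge hκ₀_pos hκ₀_le1 hκ₀_le2 (X.rep w) hz σ i j hgram_rep
  -- the kernel is the kernel majorant times the quarter Gaussians
  obtain ⟨Hf, hHf⟩ : ∃ Hf : ℝ, Hf = ∏ k, Real.exp (-(Real.pi / 4) * maj (X.ballCoord (X.rep w k)) z) := ⟨_, rfl⟩
  have hHf0 : 0 ≤ Hf := by rw [hHf]; exact Finset.prod_nonneg fun k _ => (Real.exp_pos _).le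
  have hker : ‖X.kernel D.Φ (X.rep w) z‖ = X.kerMaj D (X.rep w) z * Hf := by
    unfold kerMaj
    rw [hHf, mul_assoc, ← Finset.prod_mul_distrib]
    have h1 : ∀ k, Real.exp (Real.pi / 4 * maj (X.ballCoord (X.rep w k)) z) *
        Real.exp (-(Real.pi / 4) * maj (X.ballCoord (X.rep w k)) z) = 1 := fun k => by
      rw [← Real.exp_add, show Real.pi / 4 * maj (X.ballCoord (X.rep w k)) z +
        -(Real.pi / 4) * maj (X.ballCoord (X.rep w k)) z = 0 by ring, Real.exp_zero]
    simp only [h1, Finset.prod_const_one, mul_one]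
  rw [← hHf] at hdecay
  -- the bound for every `g ∈ Γ⁴`
  have hkm0 : 0 ≤ X.kerMaj D (X.rep w) z := X.kerMaj_nonneg D _ z
  have hg : ∀ g : Fin 4 → X.Γ, ‖X.summand D.Φ D.cf (ℓ.loc N) w z‖ ≤
      (max B 0 * q₂ ^ N * X.kerMaj D (X.rep w) z * Real.exp (-(κ₀ * R'))) * X.quadMaj e c₀ (X.rep w) g := by
    intro g
    unfold summand
    rw [norm_mul, hker]
    have hcoef' : ‖X.coefQ D.cf (ℓ.loc N) (X.rep w)‖ ≤
        max B 0 * q₂ ^ N * X.quadMaj e c₀ (X.rep w) g * ∏ k, X.gaussDefAt c₀ (X.rep w k) :=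
      (hgrowth N w g).trans (mul_le_mul_of_nonneg_right (mul_le_mul_of_nonneg_right
        (mul_le_mul_of_nonneg_right (le_max_left _ _) (pow_nonneg hq₂ _)) (X.quadMaj_nonneg _ _ _ _))
        (Finset.prod_nonneg fun _ _ => X.gaussDefAt_nonneg _ _))
    calc ‖X.coefQ D.cf (ℓ.loc N) (X.rep w)‖ * (X.kerMaj D (X.rep w) z * Hf)
        ≤ (max B 0 * q₂ ^ N * X.quadMaj e c₀ (X.rep w) g * ∏ k, X.gaussDefAt c₀ (X.rep w k)) *
            (X.kerMaj D (X.rep w) z * Hf) :=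
          mul_le_mul_of_nonneg_right hcoef' (mul_nonneg hkm0 hHf0)
      _ = (max B 0 * q₂ ^ N * X.kerMaj D (X.rep w) z * X.quadMaj e c₀ (X.rep w) g) *
            ((∏ k, X.gaussDefAt c₀ (X.rep w k)) * Hf) := by ring
      _ ≤ (max B 0 * q₂ ^ N * X.kerMaj D (X.rep w) z * X.quadMaj e c₀ (X.rep w) g) * Real.exp (-(κ₀ * R')) :=
          mul_le_mul_of_nonneg_left hdecay (mul_nonneg (mul_nonneg (mul_nonneg (le_max_right _ _)
            (pow_nonneg hq₂ _)) hkm0) (X.quadMaj_nonneg _ _ _ _))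
      _ = (max B 0 * q₂ ^ N * X.kerMaj D (X.rep w) z * Real.exp (-(κ₀ * R'))) * X.quadMaj e c₀ (X.rep w) g := by
          ring
  -- pass to the infimum over `Γ⁴`
  have hinf : ‖X.summand D.Φ D.cf (ℓ.loc N) w z‖ ≤
      (max B 0 * q₂ ^ N * X.kerMaj D (X.rep w) z * Real.exp (-(κ₀ * R'))) * X.gammaInf e c₀ (X.rep w) := by
    unfold gammaInf
    rw [Real.mul_iInf_of_nonneg (mul_nonneg (mul_nonneg (mul_nonneg (le_max_right _ _) (pow_nonneg hq₂ _)) hkm0)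
      (Real.exp_pos _).le)]
    haveI := X.nonempty_gammaFour
    exact le_ciInf hg
  -- assemble
  have hexp : Real.exp (-(κ₀ * R')) = Real.exp (κ₀ * G₀) * Real.exp (-(κ₀ / Dmax * RN)) := by
    rw [← Real.exp_add, hR']
    congr 1
    ring
  calc ‖X.summand D.Φ D.cf (ℓ.loc N) w z‖
      ≤ (max B 0 * q₂ ^ N * X.kerMaj D (X.rep w) z * Real.exp (-(κ₀ * R'))) * X.gammaInf e c₀ (X.rep w) := hinf
    _ = max B 0 * q₂ ^ N * X.invMajorant D e c₀ w z * (Real.exp (κ₀ * G₀) * Real.exp (-(κ₀ / Dmax * RN))) := by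
        unfold invMajorant
        rw [hexp]
        ring
    _ = max B 0 * q₂ ^ N * X.invMajorant D e c₀ w z *
        (Real.exp (κ₀ * G₀) * Real.exp (-(κ₀ / Dmax *
          (((Ideal.absNorm p.asIdeal : ℝ) ^ N) ^ ((Module.finrank ℚ X.E : ℝ)⁻¹))))) := by rw [hRN]

end T4Data

end Summit.Ventures.HodgeRepro.Tier4.Line3

end
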